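import Summits.CriticalPhenomena.SAWScalingLimit.Theorems.SAWTotalPositivityCriticalBubbleBoundJoinBigDefs

/-!
# Non-vacuity and the CEILING of the size knob `BigMassFraction ν'`
(crux `SAWTotalPositivity.CriticalBubbleBound`, stmt-CriticalPhenomena-7117; line `docking-census-joining`,
registered stubs `cterm_pos_of_odd`, `blockMass_jterm_pos`, `not_bigMassFraction_of_one_lt`, lead prover c8)

The size knob of the macroscopic door, `BigMassFraction ν'` (for all large `i`, a fixed fraction of the
critical mass `R'_i = blockMass jterm i` of the dyadic block `B_i = [2^i, 2^{i+1})` is carried by classes of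
linear size `max (height, width) ≥ 2^{ν' i}`), is a statement about ratios of block masses; this file
certifies that it is not vacuous and records its trivial ceiling:

* `cterm_pos_of_odd` — `cterm (2k+1) > 0` for `k ≥ 1`: the THIN COLUMN polygon
  `0 → (0,k) → (1,k) → (1,0) = e₀` (the boundary of the `1 × k` rectangle; `thinColumn_mem_lexRooted`,
  `lexRooted_odd_nonempty`) is a lex-rooted class of walk length `2k+1`, and `x_c > 0`;
* `blockMass_jterm_pos` — `R'_i > 0` for `i ≥ 5`: the block `B_i` (of length `2^i ≥ 32`) contains the
  shifted index `n = 2^i + 20` with `n - 17 = 2 (2^{i-1} + 1) + 1` odd;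
* `not_bigMassFraction_of_one_lt` — the CEILING `ν' ≤ 1`: a class of walk length `m < 2^{i+1}` has all its
  vertices within sup-distance `m` of the root, so `max (height, width) ≤ 2m < 2^{i+2} ≤ 2^{ν' i}` once
  `(ν' - 1) i ≥ 2`; then `bigMass ν' i = 0 < c · R'_i`, so `BigMassFraction ν'` fails for every `ν' > 1`.

Sources: N. Madras, G. Slade, *The Self-Avoiding Walk* (1993), §1.1 (walks, polygons, the exponent `ν`);
A. Hammond, Ann. Probab. 46 (2018) = arXiv:1808.09032, Lemma 4.11 (linear size of the joined classes).
-/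

noncomputable section

open Literature.Probability.LatticeModels
open Literature.Probability.RandomPlanarGeometry Literature.Probability.RandomPlanarGeometry.SAW
open scoped BigOperators
open Summit.CriticalPhenomena.SAWScalingLimit.Theorems.CriticalBubbleBound.Negative (e₀)
open Summit.CriticalPhenomena.SAWScalingLimit.Theorems.CriticalBubbleBound.Docking

namespace Summit.CriticalPhenomena.SAWScalingLimit.Theorems.CriticalBubbleBound.Join

/-! ## Unit steps of `ℤ²` and lexicographic nonnegativity -/

/-- A unit step NORTH is an edge of `ℤ²`. [folklore] -/
private theorem adj_of_north {x y : Site 2} (h0 : y 0 = x 0) (h1 : y 1 = x 1 + 1) :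
    (zdGraph 2).Adj x y := by
  rw [zdGraph_adj_iff]
  refine ⟨1, Or.inl (funext fun c => ?_)⟩
  fin_cases c
  · simp [h0]
  · simp [h1]

/-- A unit step EAST is an edge of `ℤ²`. [folklore] -/
private theorem adj_of_east {x y : Site 2} (h0 : y 0 = x 0 + 1) (h1 : y 1 = x 1) :
    (zdGraph 2).Adj x y := by
  rw [zdGraph_adj_iff]
  refine ⟨0, Or.inl (funext fun c => ?_)⟩
  fin_cases c
  · simp [h0]
  · simp [h1]

/-- A site of the closed first quadrant is lexicographically nonnegative. [folklore] -/
private theorem lexPos_of_nonneg {x : Site 2} (h0 : 0 ≤ x 0) (h1 : 0 ≤ x 1) : LexPos x := by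
  rcases h1.lt_or_eq with h | h
  · exact Or.inl h
  · exact Or.inr ⟨h.symm, h0⟩

/-! ## The thin column polygon: `cterm (2k+1) > 0` -/

section ThinColumn

/-! The THIN COLUMN polygon of walk length `2k+1` is described through its defining hypothesis
`hχ : ∀ j, χ j = if j ≤ k then (0, j) else (1, 2k+1-j)` (truncated subtraction): up the column `x = 0`
from the root `0` to `(0,k)`, one step east, down the column `x = 1` to `e₀ = (1,0)`, frozen there from
time `2k+1` on; closed up by the root edge it is the boundary of the `1 × k` rectangle. -/

variable {k : ℕ} {χ : ℕ → Site 2}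
  (hχ : ∀ j, χ j = if j ≤ k then ![0, (j : ℤ)] else ![1, ((2 * k + 1 - j : ℕ) : ℤ)])
include hχ

/-- Abscissa of the thin column polygon: `0` up to time `k`, then `1`. [folklore] -/
theorem thinColumn_apply_zero (j : ℕ) : χ j 0 = if j ≤ k then 0 else 1 := by
  rw [hχ j]
  split_ifs <;> rfl

/-- Ordinate of the thin column polygon: `j` up to time `k`, then `2k+1-j` (truncated). [folklore] -/
theorem thinColumn_apply_one (j : ℕ) : χ j 1 = if j ≤ k then (j : ℤ) else ((2 * k + 1 - j : ℕ) : ℤ) := by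
  rw [hχ j]
  split_ifs <;> rfl

/-- The thin column polygon starts at the root. [folklore] -/
theorem thinColumn_zero : χ 0 = 0 := by
  funext c
  fin_cases c
  · simp [thinColumn_apply_zero hχ]
  · simp [thinColumn_apply_one hχ]

/-- The thin column polygon is frozen at `e₀` from time `2k+1` on. [folklore] -/
theorem thinColumn_of_le {i : ℕ} (hi : 2 * k + 1 ≤ i) : χ i = e₀ := by
  have hk : ¬ i ≤ k := by omega
  have hsub : 2 * k + 1 - i = 0 := by omega
  funext c
  fin_cases c
  · simp [thinColumn_apply_zero hχ, hk, e₀]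
  · simp [thinColumn_apply_one hχ, hk, hsub, e₀]

/-- Consecutive vertices of the thin column polygon are lattice neighbours. [folklore] -/
theorem thinColumn_adj {i : ℕ} (hi : i < 2 * k + 1) : (zdGraph 2).Adj (χ i) (χ (i + 1)) := by
  rcases Nat.lt_trichotomy (i + 1) (k + 1) with h | h | h
  · -- going north along the column `x = 0`
    have h1 : i ≤ k := by omega
    have h2 : i + 1 ≤ k := by omega
    refine adj_of_north ?_ ?_
    · simp [thinColumn_apply_zero hχ, h1, h2]
    · simp [thinColumn_apply_one hχ, h1, h2]
  · -- the east step `(0,k) → (1,k)`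
    have h1 : i ≤ k := by omega
    have h2 : ¬ i + 1 ≤ k := by omega
    have h3 : 2 * k + 1 - (i + 1) = i := by omega
    refine adj_of_east ?_ ?_
    · simp [thinColumn_apply_zero hχ, h1, h2]
    · simp [thinColumn_apply_one hχ, h1, h2, h3]
  · -- going south along the column `x = 1`
    have h1 : ¬ i ≤ k := by omega
    have h2 : ¬ i + 1 ≤ k := by omega
    have h3 : 2 * k + 1 - i = (2 * k + 1 - (i + 1)) + 1 := by omega
    refine (adj_of_north ?_ ?_).symm
    · simp [thinColumn_apply_zero hχ, h1, h2]
    · simp [thinColumn_apply_one hχ, h1, h2, h3]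

/-- The thin column polygon visits no site twice during `[0, 2k+1]`. [folklore] -/
theorem thinColumn_injOn : Set.InjOn χ {i | i ≤ 2 * k + 1} := by
  intro i hi j hj hij
  simp only [Set.mem_setOf_eq] at hi hj
  have h0 := congrFun hij 0
  have h1 := congrFun hij 1
  simp only [thinColumn_apply_zero hχ] at h0
  simp only [thinColumn_apply_one hχ] at h1
  split_ifs at h0 h1 with hik hjk hjk
  · exact_mod_cast h1
  · exact absurd h0 zero_ne_one
  · exact absurd h0 one_ne_zero
  · have := (Nat.cast_inj (R := ℤ)).1 h1
    omega

/-- Every vertex of the thin column polygon is lexicographically nonnegative (it lies in the closed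
first quadrant). [folklore] -/
theorem lexPos_thinColumn (j : ℕ) : LexPos (χ j) := by
  refine lexPos_of_nonneg ?_ ?_
  · rw [thinColumn_apply_zero hχ]
    split_ifs <;> norm_num
  · rw [thinColumn_apply_one hχ]
    split_ifs <;> exact Nat.cast_nonneg _

/-- **The thin column polygon is a lex-rooted class of walk length `2k+1`** (a `(2k+2)`-edge
self-avoiding polygon through the root edge, lowest-leftmost vertex at the root). [cite: MadrasSlade1993, §1.1] -/
theorem thinColumn_mem_lexRooted : χ ∈ lexRooted (2 * k + 1) :=
  mem_lexRooted.2 ⟨Zd.mem_sawFun.2 ⟨thinColumn_zero hχ, fun _ hi => thinColumn_of_le hχ hi,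
    fun _ hi => thinColumn_adj hχ hi, thinColumn_injOn hχ⟩, fun m _ => lexPos_thinColumn hχ m⟩

end ThinColumn

/-- **There is a lex-rooted class of every odd walk length `2k+1`**: the thin column polygon
`j ↦ (0, j)` (`j ≤ k`), `j ↦ (1, 2k+1-j)` (`k < j ≤ 2k+1`), `e₀` afterwards. [cite: MadrasSlade1993, §1.1] -/
theorem lexRooted_odd_nonempty (k : ℕ) : (lexRooted (2 * k + 1)).Nonempty :=
  ⟨fun j => if j ≤ k then ![0, (j : ℤ)] else ![1, ((2 * k + 1 - j : ℕ) : ℤ)],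
    thinColumn_mem_lexRooted fun _ => rfl⟩

/-- **Non-vacuity of the class masses** (registered stub): `cterm (2k+1) > 0` for every `k ≥ 1` — the
thin column polygon is a lex-rooted class of walk length `2k+1`, and `x_c > 0`. (The hypothesis `1 ≤ k`
is not used: for `k = 0` the one-step walk `0 → e₀` is the degenerate witness.) [cite: MadrasSlade1993, §1.1] -/
theorem cterm_pos_of_odd : ∀ k : ℕ, 1 ≤ k → 0 < cterm (2 * k + 1) := by
  intro k _
  rw [cterm]
  exact mul_pos (Nat.cast_pos.2 (Finset.card_pos.2 (lexRooted_odd_nonempty k)))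
    (pow_pos criticalFugacity_pos_lt_one'.1 _)

/-! ## Non-vacuity of the shifted block masses -/

/-- **The shifted block masses are positive** (registered stub): `R'_i = blockMass jterm i > 0` for
`i ≥ 5`. The block `B_i = [2^i, 2^{i+1})` has length `2^i ≥ 32`, so it contains the shifted index
`n = 2^i + 20`, whose class length `n - 17 = 2^i + 3 = 2 (2^{i-1} + 1) + 1` is odd `≥ 3`; all other
terms are nonnegative. [folklore] -/
theorem blockMass_jterm_pos : ∀ i : ℕ, 5 ≤ i → 0 < blockMass jterm i := by
  intro i hi
  obtain ⟨j, rfl⟩ := Nat.exists_eq_succ_of_ne_zero (by omega : i ≠ 0)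
  have h32 : 32 ≤ 2 ^ (j + 1) :=
    calc (32 : ℕ) = 2 ^ 5 := by norm_num
      _ ≤ 2 ^ (j + 1) := Nat.pow_le_pow_right two_pos hi
  have hpow : 2 ^ (j + 1) = 2 * 2 ^ j := pow_succ' 2 j
  have hpow' : 2 ^ (j + 1 + 1) = 2 * 2 ^ (j + 1) := pow_succ' 2 (j + 1)
  have hmem : 2 ^ (j + 1) + 20 ∈ block (j + 1) := by
    rw [block, Finset.mem_Ico]
    omega
  have hj : jterm (2 ^ (j + 1) + 20) = cterm (2 * (2 ^ j + 1) + 1) := by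
    rw [jterm_of_le (show 17 ≤ 2 ^ (j + 1) + 20 by omega)]
    congr 1
    show 2 ^ (j + 1) + 20 - 17 = 2 * (2 ^ j + 1) + 1
    omega
  calc (0 : ℝ) < jterm (2 ^ (j + 1) + 20) := by
        rw [hj]
        exact cterm_pos_of_odd _ (Nat.le_add_left 1 _)
    _ ≤ blockMass jterm (j + 1) := Finset.single_le_sum (fun n _ => jterm_nonneg n) hmem

/-! ## The ceiling: no size exponent above `1` -/

/-- `xmin` is attained by a vertex. [folklore] -/
private theorem exists_apply_eq_xmin' (n : ℕ) (χ : ℕ → Site 2) : ∃ i ≤ n, χ i 0 = xmin n χ := by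
  obtain ⟨i, hi, h⟩ := Finset.mem_image.1 (Finset.min'_mem (xs n χ) (xs_nonempty n χ))
  exact ⟨i, Nat.lt_succ_iff.1 (Finset.mem_range.1 hi), h⟩

/-- **Linear size is at most twice the length**: every vertex of a rooted `m`-step walk lies within
sup-distance `m` of the root, so `max (height, width) ≤ 2m`. [cite: MadrasSlade1993, §1.1] -/
theorem max_height_width_le_two_mul {m : ℕ} {χ : ℕ → Site 2} (h : χ ∈ Zd.sawFun 2 m e₀) :
    max (height m χ) (width m χ) ≤ 2 * (m : ℤ) := by
  obtain ⟨h0, -, hadj, -⟩ := Zd.mem_sawFun.1 h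
  have hb : ∀ i ≤ m, ∀ j, |χ i j| ≤ (m : ℤ) := fun i hi j =>
    (Zd.abs_apply_le_of_adj h0 hadj i hi j).trans (by exact_mod_cast hi)
  obtain ⟨a, ha, hax⟩ := exists_apply_eq_xmax m χ
  obtain ⟨a', ha', hax'⟩ := exists_apply_eq_xmin' m χ
  obtain ⟨b, hb', hby⟩ := exists_apply_eq_ymax m χ
  obtain ⟨b', hb'', hby'⟩ := exists_apply_eq_ymin m χ
  have h1 := (abs_le.1 (hb a ha 0)).2
  have h2 := (abs_le.1 (hb a' ha' 0)).1
  have h3 := (abs_le.1 (hb b hb' 1)).2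
  have h4 := (abs_le.1 (hb b' hb'' 1)).1
  rw [hax] at h1
  rw [hax'] at h2
  rw [hby] at h3
  rw [hby'] at h4
  simp only [height, width, max_le_iff]
  omega

/-- **No class of a block is big above exponent `1`**: if `m < 2^{i+1}` and `i + 2 ≤ ν' i`, then
`max (height, width) ≤ 2m < 2^{i+2} ≤ 2^{ν' i}`, so `IsBigAt ν' i m χ` fails. [folklore] -/
theorem not_isBigAt_of_lt {ν' : ℝ} {i m : ℕ} {χ : ℕ → Site 2} (hχ : χ ∈ Zd.sawFun 2 m e₀)
    (hm : m < 2 ^ (i + 1)) (hνi : (i : ℝ) + 2 ≤ ν' * i) : ¬ IsBigAt ν' i m χ := by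
  intro hbig
  unfold IsBigAt at hbig
  have h1 : max (height m χ) (width m χ) < 2 ^ (i + 2) := by
    have h2 := max_height_width_le_two_mul hχ
    have h3 : (m : ℤ) < 2 ^ (i + 1) := by exact_mod_cast hm
    have h4 : (2 : ℤ) ^ (i + 2) = 2 * 2 ^ (i + 1) := by rw [pow_succ']
    rw [h4]
    omega
  have h2 : ((max (height m χ) (width m χ) : ℤ) : ℝ) < (2 : ℝ) ^ (i + 2) := by exact_mod_cast h1
  have h3 : (2 : ℝ) ^ (i + 2) ≤ (2 : ℝ) ^ (ν' * i) := by
    rw [← Real.rpow_natCast]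
    exact Real.rpow_le_rpow_of_exponent_le one_le_two (by push_cast; linarith)
  linarith

/-- **Above exponent `1` the big mass of a large block vanishes**: for `i + 2 ≤ ν' i` no class of
shifted index in `B_i` is big, so `bigMass ν' i = 0`. [folklore] -/
theorem bigMass_eq_zero_of_le {ν' : ℝ} {i : ℕ} (hνi : (i : ℝ) + 2 ≤ ν' * i) : bigMass ν' i = 0 := by
  classical
  refine Finset.sum_eq_zero fun n hn => ?_
  rw [block, Finset.mem_Ico] at hn
  split_ifs with h17
  · rw [Finset.filter_false_of_mem, Finset.card_empty, Nat.cast_zero, zero_mul]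
    intro χ hχ
    exact not_isBigAt_of_lt (lexRooted_subset _ hχ) (lt_of_le_of_lt (Nat.sub_le n joinShift) hn.2) hνi
  · rfl

/-- **The ceiling of the size knob** (registered stub): `BigMassFraction ν'` fails for every `ν' > 1`.
Choose `i ≥ max i₀ 5` with `(ν' - 1) i ≥ 2`: then `bigMass ν' i = 0` (`bigMass_eq_zero_of_le`) while
`c · R'_i > 0` (`blockMass_jterm_pos`), contradicting `c · R'_i ≤ bigMass ν' i`. (So the size input of the
entropy knob lives in `ν' ∈ [0, 1]`; conjecturally it holds exactly for `ν' < ν = 3/4`.)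
[cite: MadrasSlade1993, §1.1] -/
theorem not_bigMassFraction_of_one_lt : ∀ ν' : ℝ, 1 < ν' → ¬ BigMassFraction ν' := by
  intro ν' hν' hB
  obtain ⟨c, hc, i₀, h⟩ := hB
  obtain ⟨i₁, hi₁⟩ := exists_nat_ge (2 / (ν' - 1))
  obtain ⟨i, hi₀i, hi₁i, hi5⟩ : ∃ i : ℕ, i₀ ≤ i ∧ i₁ ≤ i ∧ 5 ≤ i :=
    ⟨max (max i₀ i₁) 5, le_trans (le_max_left _ _) (le_max_left _ _),
      le_trans (le_max_right _ _) (le_max_left _ _), le_max_right _ _⟩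
  have hν1 : 0 < ν' - 1 := sub_pos.2 hν'
  have hνi : (i : ℝ) + 2 ≤ ν' * i := by
    have h1 : 2 / (ν' - 1) ≤ (i : ℝ) := hi₁.trans (by exact_mod_cast hi₁i)
    have h2 : 2 ≤ (ν' - 1) * i := by
      rw [div_le_iff₀ hν1] at h1
      linarith
    have h3 : (ν' - 1) * i = ν' * i - i := by ring
    linarith
  have hle := h i hi₀i
  rw [bigMass_eq_zero_of_le hνi] at hle
  have hpos : 0 < c * blockMass jterm i := mul_pos hc (blockMass_jterm_pos i hi5)
  linarith

end Summit.CriticalPhenomena.SAWScalingLimit.Theorems.CriticalBubbleBound.Join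

end
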